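import Summits.QuantumFields.BalabanUV.Beta.GAN24.CombBornBorderLineage
import Summits.QuantumFields.BalabanUV.Beta.GAN24.BornBorderLetters

/-!
# The (III′) V-born sector of the comb-chart remainder in units = source + UNDRESSED lineages + contact terms, and the socket `hV ⟸ hUv ∧ hCv`
# (the born V-table's own locality discharged; per-lineage geometric ∕ poly-geometric letters)

NOT IN PRINT — OUR BOOKKEEPING (road-P2 = `b2b-balaban-gan24-p2` gen 56, 2026-08-25; row G-an2-4 ∕ (CONV-C), the (α-0) chain at row D1's literal
OF RECORD (III′) `JsB12CombShSym`; [folklore] composition BY NAME; 0 `def`, 0 cite, 0 `def … : Prop`, 0 `sorry`).  Weight 0.  NEVER «G-an2-4 closed» as (CONV-C);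
NOT D1, NOT BetaPertH, NOT continuum, NOT Clay; NO campaign opened (an2 W-4).

This is the (III′) twin of leaf-01 g60's (E) `GAN24/BornBorderLetters` §2–§4 (the V half of `hB`) over M.56 `CombBornBorderLineage` (`combUnitStepMap_v_eq_two_push₃`,
`unitS_combBornV_eq_sum`, `exists_hX_v`, `unitS_combFreshAt_v`) and M.51 `CombBornSector.transport_combUnitStepMap_succ_eq_push₃`, for ANY `tabs : SymTables d Lc` with an
OFF-DIAGONAL border table (`hVff hVmm` displayed).  LOCAL NOTATION (this file only; every statement is the expanded term): `𝒱` := the TRANSPORTED V-source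
`fun κ u ↦ Ψ̂ᵀ ∘ slotPsiS (ctrOff (d+1) Lc) Lc (cVH • tabs.V) κ u ∘ Ψ̂` (`Ψ̂ = psiKS (ctrOff (d+1) Lc) Lc`; M.43's `𝒯 (cVH • tabs.V)`), `R i` := `respStepBm ρ_c Lc (Lc^i) (Lc^(i+1))`
(ONE dressed step at the centred root `ρ_c = ctr (d+1) Lc`), `R⁰ i` := `respStep (Lc^i) (Lc^(i+1))` (undressed), `B i k` := `respStep (Lc^(i+1)) (Lc^k)`, `K̃ i` := `KStepUnit Lc i`,
`T″ i n` := `legChain (fun j ↦ legComp ψ♭ (respStepBmSeq ρ_c Lc j)) (i+1) n` (the CONJUGATED chain), `w` := `cE·Lc^{2(d+1)}`.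
* §1 **THE DRESSED ONE-STEP IMAGE WITH ITS PREFACTOR PULLED OUT** `X_i = w • Y_i`, `Y_i = −(push₃ (−R i) (colM (K̃ i) Lc) R[i] (reslot inl inr 𝒱) + push₃ (rowMM (K̃ i) Lc) R[i] R[i]
  (reslot inr inl 𝒱))` (`combUnitStepMap_v_apply`, M.56 pointwise) and **THE ONE-STEP TELESCOPE** `X_i − w • Y⁰_i` (`Y⁰_i`: `R i ↦ R⁰ i` in both mixed channels, multiplier legs
  untouched) displayed channel by channel in the shape of leaf-02's `ContactBorderKernelCells.contact_border_fm_eq_cells ∕ _mf_eq_cells` (`combUnitStepMap_v_sub_undressed`).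
* §2 the lineages: `dressed_v_succ` (`D_{i,k} := transport combUnitStepMap (i+1) (n+1) X_i = w^{n+1} • push₃ (T″ i n)³ X_i`), `dressed_v_top`, `undressed_v_top`
  (`U_{k−1,k} = w • Y⁰_{k−1}`: leaf-01's identity-leg push `push₃_respStep_self` BY NAME).
* §3 **MEMBER `k` = SOURCE + UNDRESSED LINEAGES + CONTACT TERMS** (`unitS_combBornV_eq_source_add_undressed_add_contact`):
  `unitS_k (combBornOf Lc tabs cE cVH 0 k) = cVH • tabs.V + Σ_{i<k} U_{i,k} + Σ_{i<k} (D_{i,k} − U_{i,k})`, `U_{i,k} := w^{k−i} • push₃ (B i k)³ Y⁰_i` — leaf-01's display token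
  for token with `vhSAt ρ ↦ 𝒱` INSIDE the one-step images (the source itself stays `cVH • tabs.V`: M.56 §1), `unitStepMap ρ ↦ combUnitStepMap`, `T′ ↦ T″`.
* §4 **THE SOCKET** `exists_hBv_of_letters (hVff hVmm) (cE cVH) (hUv) (hCv)` : the letter `hV` of M.57 `CombBornSectorSplit.exists_hB_of_sectors`
  (`∃ C δ, 0 < δ ∧ ∀ k, LocStencil (unitS_k (combBornOf Lc tabs cE cVH 0 k)) C δ`) — M.56's `exists_hX_v` discharges the source letter at the common rate; the per-lineage
  forms `exists_hUv_of_geometric`, `exists_hCv_of_geometric`, `exists_hCv_of_polyGeometric`, **`exists_hBv_of_geometric`**, **`exists_hBv_of_geometric_poly`**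
  (leaf-01's `locStencil_sum_of_geometric` ∕ leaf-03's `locStencil_sum_of_polyGeometric` BY NAME).
At (III′) there is no in-block-root quantifier (centred roots).  WHAT IS NEW against (E), located: the undressed lineages read the TRANSPORTED table `𝒱` (local by M.43
`locStencil_transportPsiS` over (LV)), and the deeper contact terms telescope through `T″ − B` = (E)'s pure gauge + the OWNER's face term (M.59 `combLegChain_sub_respStep_of_lt`).
Discharges NO letter but the source's; NO estimate; NO value ∕ rate of Bałaban's tables.
-/

noncomputable section

open Finset
open scoped BigOperators
open Literature.MathematicalPhysics.QuantumFieldTheory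
open Literature.MathematicalPhysics.QuantumFieldTheory.Balaban1983to89
open Literature.MathematicalPhysics.QuantumFieldTheory.Balaban1983to89.Beta
open ExpKernelCalculus (MKer comp)
open AffineAveraging (Site box toSite)
open AveragingContoursRooted (ctr ctrOff ctrOff_mem_box)
open OneStepResolventKernel (Fib LocStencil)
open AveragingHessianKernels (ell)
open StepJetData (locStencil_add locStencil_smul)
open BalabanStepJets (locStencil_mono)
open BalabanCompositeJets (respStep)
open Summit.QuantumFields.BalabanUV.Beta.TameKernelCalculus (trK)
open Summit.QuantumFields.BalabanUV.Beta.HessKerDressedUnits (unitS)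
open Summit.QuantumFields.BalabanUV.Beta.AxialDressingRooted (one_le_of_neZero)
open Summit.QuantumFields.BalabanUV.Beta.SymCorrectorKernel (psiKS)
open Summit.QuantumFields.BalabanUV.Beta.SymCorrectorFace (slotPsiS)
open Summit.QuantumFields.BalabanUV.Beta.SymmetrisedStepJets (SymTables)
open Summit.QuantumFields.BalabanUV.Beta.GAN24.CombesThomas (sfStep smStep KStepUnit)
open Summit.QuantumFields.BalabanUV.Beta.GAN24.Push4 (legComp IsFF)
open Summit.QuantumFields.BalabanUV.Beta.GAN24.Push4Iter (legChain)
open Summit.QuantumFields.BalabanUV.Beta.GAN24.Push3 (push₃)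
open Summit.QuantumFields.BalabanUV.Beta.GAN24.AffineUnroll (transport transport_zero)
open Summit.QuantumFields.BalabanUV.Beta.GAN24.RespStepBmDecompExact (respStepBmSeq)
open Summit.QuantumFields.BalabanUV.Beta.GAN24.RespStepBm (respStepBm)
open Summit.QuantumFields.BalabanUV.Beta.GAN24.SrecLinearPartEq (colM rowMM reslot)
open Summit.QuantumFields.BalabanUV.Beta.GAN24.BornBorderLetters (push₃_respStep_self isFF_twoPush)
open Summit.QuantumFields.BalabanUV.Beta.GAN24.BornLambdaLetters (locStencil_sum_of_geometric)
open Summit.QuantumFields.BalabanUV.Beta.GAN24.BornLambdaLettersPoly (locStencil_sum_of_polyGeometric)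
open Summit.QuantumFields.BalabanUV.Beta.GAN24.CombWilsonSector (combBornOf)
open Summit.QuantumFields.BalabanUV.Beta.GAN24.CombBornSector (combFreshAt combUnitStepMap transport_combUnitStepMap_succ_eq_push₃)
open Summit.QuantumFields.BalabanUV.Beta.GAN24.CombBornBorderLineage (unitS_combBornV_eq_sum combUnitStepMap_v_eq_two_push₃ isFF_combUnitStepMap_v isLoc_combUnitStepMap_v
  exists_hX_v unitS_combFreshAt_v)

namespace Summit.QuantumFields.BalabanUV.Beta.GAN24.CombBornBorderLetters

variable {d : ℕ} {Lc : ℕ} [NeZero Lc] (tabs : SymTables d Lc) (hVff : ∀ κ u x y (α β : Fin (d + 1)), tabs.V κ u x y (Sum.inl α) (Sum.inl β) = 0)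
  (hVmm : ∀ κ u x y (μ ν : Fin (d + 1)), tabs.V κ u x y (Sum.inr μ) (Sum.inr ν) = 0) (cE cVH : ℝ)

/-- The transported V-source `𝒯 (cVH • tabs.V)` (local notation; M.43's transport read through M.51's `combUnitStepMap`). -/
local notation:max "𝒱" => (fun κ u => comp (comp (trK (psiKS (ctrOff (d + 1) Lc) Lc)) (slotPsiS (ctrOff (d + 1) Lc) Lc (fun κ u => cVH • SymTables.V tabs κ u) κ u))
  (psiKS (ctrOff (d + 1) Lc) Lc))
/-- One dressed step at the centred root (local notation). -/
local notation:max "R[" i "]" => respStepBm (ctr (d + 1) Lc) Lc (Lc ^ i) (Lc ^ (i + 1))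
/-- One undressed step (local notation). -/
local notation:max "R⁰[" i "]" => respStep (d := d) (Lc ^ i) (Lc ^ (i + 1))
/-- The undressed outer legs of the lineage born at `i`, read at `k` (local notation). -/
local notation:max "B[" i "," k "]" => respStep (d := d) (Lc ^ (i + 1)) (Lc ^ k)
/-- The conjugated dressed leg chain from level `i+1`, `n+1` legs (local notation). -/
local notation:max "T″[" i "," n "]" => legChain (fun j => legComp (fun α x κ u => psiKS (ctrOff (d + 1) Lc) Lc u x (Sum.inl κ) (Sum.inl α)) (respStepBmSeq (ctr (d + 1) Lc) Lc j)) (i + 1) n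

/-! ## §1 The dressed one-step image with its prefactor pulled out; the one-step telescope -/

include hVff hVmm in
/-- NOT IN PRINT; OUR BOOKKEEPING ([folklore]; M.56 `combUnitStepMap_v_eq_two_push₃` restated pointwise — the (III′) twin of leaf-01's `unitStepMap_v_apply`).
**THE DRESSED ONE-STEP IMAGE WITH ITS PREFACTOR PULLED OUT**: `X_i = w • Y_i`, `Y_i := −(push₃ (−R_i) (colM K̃_i Lc) R_i (reslot inl inr 𝒱) + push₃ (rowMM K̃_i Lc) R_i R_i (reslot inr inl 𝒱))`. -/
theorem combUnitStepMap_v_apply (i : ℕ) (κ' : Fin (d + 1)) (u' : Fin (d + 1) → ℤ) :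
    combUnitStepMap Lc cE i (fun κ u => cVH • tabs.V κ u) κ' u'
      = ((cE * (Lc : ℝ) ^ (2 * (d + 1))) •
        (fun κ u => -(push₃ (-R[i]) (colM (KStepUnit (d := d) Lc i) Lc) R[i] (reslot Sum.inl Sum.inr 𝒱) κ u
          + push₃ (rowMM (KStepUnit (d := d) Lc i) Lc) R[i] R[i] (reslot Sum.inr Sum.inl 𝒱) κ u))) κ' u' := by
  rw [combUnitStepMap_v_eq_two_push₃ tabs hVff hVmm cE cVH i]
  rfl

include hVff hVmm in
/-- NOT IN PRINT; OUR BOOKKEEPING (the (III′) twin of leaf-01's `unitStepMap_v_sub_undressed`).  **THE ONE-STEP TELESCOPE OF THE (III′) V-LINEAGE**: the dressed one-step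
image minus the UNDRESSED one (`R_i ↦ R⁰_i` in both mixed channels, multiplier legs untouched) is `w •` the NEGATIVE of the sum of the two channel differences
`[push₃ (−R_i) (colM K̃_i) R_i S − push₃ (−R⁰_i) (colM K̃_i) R⁰_i S] + [push₃ (rowMM K̃_i) R_i R_i S′ − push₃ (rowMM K̃_i) R⁰_i R⁰_i S′]`, `S = reslot inl inr 𝒱`, `S′ = reslot inr inl 𝒱` —
each bracket is the input of leaf-02's `ContactBorderKernelCells.contact_border_fm_eq_cells ∕ _mf_eq_cells` ON THE TRANSPORTED TABLE. -/
theorem combUnitStepMap_v_sub_undressed (i : ℕ) (κ' : Fin (d + 1)) (u' : Fin (d + 1) → ℤ) :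
    combUnitStepMap Lc cE i (fun κ u => cVH • tabs.V κ u) κ' u'
        - ((cE * (Lc : ℝ) ^ (2 * (d + 1))) •
          (fun κ u => -(push₃ (-R⁰[i]) (colM (KStepUnit (d := d) Lc i) Lc) R⁰[i] (reslot Sum.inl Sum.inr 𝒱) κ u
            + push₃ (rowMM (KStepUnit (d := d) Lc i) Lc) R⁰[i] R⁰[i] (reslot Sum.inr Sum.inl 𝒱) κ u))) κ' u'
      = -((cE * (Lc : ℝ) ^ (2 * (d + 1))) •
          ((push₃ (-R[i]) (colM (KStepUnit (d := d) Lc i) Lc) R[i] (reslot Sum.inl Sum.inr 𝒱) κ' u'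
              - push₃ (-R⁰[i]) (colM (KStepUnit (d := d) Lc i) Lc) R⁰[i] (reslot Sum.inl Sum.inr 𝒱) κ' u')
            + (push₃ (rowMM (KStepUnit (d := d) Lc i) Lc) R[i] R[i] (reslot Sum.inr Sum.inl 𝒱) κ' u'
              - push₃ (rowMM (KStepUnit (d := d) Lc i) Lc) R⁰[i] R⁰[i] (reslot Sum.inr Sum.inl 𝒱) κ' u'))) := by
  rw [combUnitStepMap_v_apply tabs hVff hVmm cE cVH i]
  simp only [Pi.smul_apply, smul_add, smul_neg, smul_sub]
  abel

/-! ## §2 The lineages: dressed (through the conjugated chains) and undressed -/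

include hVff hVmm in
/-- NOT IN PRINT; OUR BOOKKEEPING (the (III′) twin of leaf-01's `dressed_v_succ`).  **THE DRESSED LINEAGE WITH `≥ 1` TRANSPORT STEP IS ONE WEIGHTED THREE-LEG PUSH THROUGH THE
CONJUGATED CHAIN FROM THE NEXT LEVEL**: `D_{i,k} := transport combUnitStepMap (i+1) (n+1) X_i = w^{n+1} • push₃ T″ T″ T″ X_i`, `T″ = legChain (fun j ↦ legComp ψ♭ R_j) (i+1) n`
(M.51 `transport_combUnitStepMap_succ_eq_push₃` at base `i+1`: the one-step image is ff-valued and in the class, M.56 §2). -/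
theorem dressed_v_succ (i n : ℕ) :
    transport (combUnitStepMap Lc cE) (i + 1) (n + 1) (combUnitStepMap Lc cE i (fun κ u => cVH • tabs.V κ u))
      = fun κ' u' => (cE * (Lc : ℝ) ^ (2 * (d + 1))) ^ (n + 1) •
          push₃ T″[i, n] T″[i, n] T″[i, n] (combUnitStepMap Lc cE i (fun κ u => cVH • tabs.V κ u)) κ' u' :=
  transport_combUnitStepMap_succ_eq_push₃ cE (i + 1) (fun κ u => isFF_combUnitStepMap_v tabs cE cVH i κ u) (isLoc_combUnitStepMap_v tabs hVff hVmm cE cVH i) n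

omit [NeZero Lc] in
/-- [folklore] **THE TOP DRESSED LINEAGE IS THE ONE-STEP IMAGE ITSELF**: `D_{k−1,k} = transport combUnitStepMap k 0 X_{k−1} = X_{k−1}` (`transport_zero`). -/
theorem dressed_v_top [NeZero Lc] (i : ℕ) (X : Fin (d + 1) → (Fin (d + 1) → ℤ) → MKer (d + 1) (Fib d)) :
    transport (combUnitStepMap Lc cE) (i + 1) 0 X = X :=
  transport_zero _ _ _

/-- NOT IN PRINT; OUR BOOKKEEPING (the (III′) twin of leaf-01's `undressed_v_top`).  **THE TOP UNDRESSED LINEAGE IS THE UNDRESSED ONE-STEP IMAGE**: at `i = k−1` the outer legs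
`B_{k,k} = respStep (Lc^k) (Lc^k)` are the identity legs, so `U_{k−1,k} = w • push₃ B_{k,k}³ Y⁰_{k−1} = w • Y⁰_{k−1}` (leaf-01's `push₃_respStep_self` on the ff-valued `Y⁰`). -/
theorem undressed_v_top (i : ℕ) (κ' : Fin (d + 1)) (u' : Fin (d + 1) → ℤ) :
    (cE * (Lc : ℝ) ^ (2 * (d + 1))) ^ (i + 1 - i) •
        push₃ B[i, i + 1] B[i, i + 1] B[i, i + 1]
          (fun κ u => -(push₃ (-R⁰[i]) (colM (KStepUnit (d := d) Lc i) Lc) R⁰[i] (reslot Sum.inl Sum.inr 𝒱) κ u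
            + push₃ (rowMM (KStepUnit (d := d) Lc i) Lc) R⁰[i] R⁰[i] (reslot Sum.inr Sum.inl 𝒱) κ u)) κ' u'
      = (cE * (Lc : ℝ) ^ (2 * (d + 1))) •
          (fun κ u => -(push₃ (-R⁰[i]) (colM (KStepUnit (d := d) Lc i) Lc) R⁰[i] (reslot Sum.inl Sum.inr 𝒱) κ u
            + push₃ (rowMM (KStepUnit (d := d) Lc i) Lc) R⁰[i] R⁰[i] (reslot Sum.inr Sum.inl 𝒱) κ u)) κ' u' := by
  rw [show i + 1 - i = 1 by omega, pow_one, push₃_respStep_self _ _ κ' u' (isFF_twoPush _ _ _ _ _ _ _ _ κ' u')]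

/-! ## §3 Member `k`: source + undressed lineages + contact terms -/

include hVff hVmm in
/-- NOT IN PRINT; OUR BOOKKEEPING ((III′) V sector, instance side; [folklore]; the twin of leaf-01's `unitS_bornV_eq_source_add_undressed_add_contact`).  **THE (III′) V-BORN
REMAINDER IN UNITS = SOURCE + UNDRESSED LINEAGES + CONTACT TERMS**: with `X_i := combUnitStepMap Lc cE i (cVH • tabs.V)` (M.56 §2), the DRESSED lineage
`D_{i,k} := transport combUnitStepMap (i+1) (k−1−i) X_i` and the UNDRESSED lineage `U_{i,k} := w^{k−i} • push₃ B_{i+1,k}³ (−(push₃ (−R⁰_i) (colM K̃_i Lc) R⁰_i (reslot inl inr 𝒱)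
+ push₃ (rowMM K̃_i Lc) R⁰_i R⁰_i (reslot inr inl 𝒱)))`, `unitS_k (combBornOf Lc tabs cE cVH 0 k) = cVH • tabs.V + Σ_{i<k} U_{i,k} + Σ_{i<k} (D_{i,k} − U_{i,k})`.
The middle sum is the UNDRESSED V row READ ON THE TRANSPORTED TABLE `𝒱`; each summand of the last sum is the contact term of one lineage: at the top the one-step telescope of
§1, below it the three-slot telescope `T″ − B_{i+1,k}` (M.59: ONE pure-gauge family, (E)'s `λ` plus the OWNER's `PsiFace`) composed with it. -/
theorem unitS_combBornV_eq_source_add_undressed_add_contact (k : ℕ) :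
    unitS (sfStep Lc k) (smStep d Lc k) (combBornOf Lc tabs cE cVH 0 k)
      = (fun κ u => cVH • tabs.V κ u)
        + ∑ i ∈ Finset.range k, (fun κ' u' => (cE * (Lc : ℝ) ^ (2 * (d + 1))) ^ (k - i) •
            push₃ B[i, k] B[i, k] B[i, k]
              (fun κ u => -(push₃ (-R⁰[i]) (colM (KStepUnit (d := d) Lc i) Lc) R⁰[i] (reslot Sum.inl Sum.inr 𝒱) κ u
                + push₃ (rowMM (KStepUnit (d := d) Lc i) Lc) R⁰[i] R⁰[i] (reslot Sum.inr Sum.inl 𝒱) κ u)) κ' u')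
        + ∑ i ∈ Finset.range k, (transport (combUnitStepMap Lc cE) (i + 1) (k - 1 - i) (combUnitStepMap Lc cE i (fun κ u => cVH • tabs.V κ u))
            - fun κ' u' => (cE * (Lc : ℝ) ^ (2 * (d + 1))) ^ (k - i) •
              push₃ B[i, k] B[i, k] B[i, k]
                (fun κ u => -(push₃ (-R⁰[i]) (colM (KStepUnit (d := d) Lc i) Lc) R⁰[i] (reslot Sum.inl Sum.inr 𝒱) κ u
                  + push₃ (rowMM (KStepUnit (d := d) Lc i) Lc) R⁰[i] R⁰[i] (reslot Sum.inr Sum.inl 𝒱) κ u)) κ' u') := by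
  rw [unitS_combBornV_eq_sum tabs hVff hVmm cE cVH k, add_assoc, ← Finset.sum_add_distrib]
  congr 1
  refine Finset.sum_congr rfl fun i _ => ?_
  abel

/-! ## §4 The (III′) V-born target as a socket: `hV ⟸ hUv ∧ hCv` (the source letter discharged) -/

include hVff hVmm in
/-- NOT IN PRINT; OUR BOOKKEEPING ((III′) socket, V sector; the twin of leaf-01's `exists_hBv_of_letters`).  **THE (III′) V-BORN ROW FROM TWO LETTERS**: a `k`-uniform `LocStencil`
letter for the UNDRESSED V lineages summed over the birth levels (`hUv`) and one for the CONTACT terms summed the same way (`hCv`) give the letter `hV` of M.57's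
`exists_hB_of_sectors`; the born V-table's own locality is M.56's `exists_hX_v` at the common rate (constants added; §3's identity). -/
theorem exists_hBv_of_letters
    (hU : ∃ C δ : ℝ, 0 < δ ∧ ∀ k : ℕ,
      LocStencil (∑ i ∈ Finset.range k, fun κ' u' => (cE * (Lc : ℝ) ^ (2 * (d + 1))) ^ (k - i) •
        push₃ B[i, k] B[i, k] B[i, k]
          (fun κ u => -(push₃ (-R⁰[i]) (colM (KStepUnit (d := d) Lc i) Lc) R⁰[i] (reslot Sum.inl Sum.inr 𝒱) κ u
            + push₃ (rowMM (KStepUnit (d := d) Lc i) Lc) R⁰[i] R⁰[i] (reslot Sum.inr Sum.inl 𝒱) κ u)) κ' u') C δ)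
    (hC : ∃ C δ : ℝ, 0 < δ ∧ ∀ k : ℕ,
      LocStencil (∑ i ∈ Finset.range k, (transport (combUnitStepMap Lc cE) (i + 1) (k - 1 - i) (combUnitStepMap Lc cE i (fun κ u => cVH • tabs.V κ u))
        - fun κ' u' => (cE * (Lc : ℝ) ^ (2 * (d + 1))) ^ (k - i) •
          push₃ B[i, k] B[i, k] B[i, k]
            (fun κ u => -(push₃ (-R⁰[i]) (colM (KStepUnit (d := d) Lc i) Lc) R⁰[i] (reslot Sum.inl Sum.inr 𝒱) κ u
              + push₃ (rowMM (KStepUnit (d := d) Lc i) Lc) R⁰[i] R⁰[i] (reslot Sum.inr Sum.inl 𝒱) κ u)) κ' u')) C δ) :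
    ∃ C δ : ℝ, 0 < δ ∧ ∀ k : ℕ, LocStencil (unitS (sfStep Lc k) (smStep d Lc k) (combBornOf Lc tabs cE cVH 0 k)) C δ := by
  obtain ⟨CU, δU, hδU, hU⟩ := hU
  obtain ⟨CC, δC, hδC, hC⟩ := hC
  have hδ : 0 < min δU δC := lt_min hδU hδC
  obtain ⟨CV, hV⟩ := exists_hX_v tabs hVff hVmm cVH hδ.le
  refine ⟨|cVH| * CV + CU + CC, min δU δC, hδ, fun k => ?_⟩
  have hCU : 0 ≤ CU := ((hU k) 0 0).nonneg (Sum.inl 0)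
  have hCC : 0 ≤ CC := ((hC k) 0 0).nonneg (Sum.inl 0)
  have h1 := hV 0
  rw [unitS_combFreshAt_v tabs hVff hVmm] at h1
  rw [unitS_combBornV_eq_source_add_undressed_add_contact tabs hVff hVmm cE cVH k]
  have h2 := locStencil_mono (hU k) hCU (min_le_left δU δC)
  have h3 := locStencil_mono (hC k) hCC (min_le_right δU δC)
  exact locStencil_add (locStencil_add h1 h2) h3

omit [NeZero Lc] in
/-- NOT IN PRINT; OUR BOOKKEEPING (the twin of leaf-01's `exists_hUv_of_geometric`).  **THE UNDRESSED-LINEAGE LETTER `hUv` FROM A PER-LINEAGE GEOMETRIC LETTER**: per-lineage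
constants `C·θ^{k−i}` at one rate (`0 ≤ C`, `0 ≤ θ < 1`) ⇒ the sum over `i < k` with the `k`-free constant `C·θ∕(1−θ)`. -/
theorem exists_hUv_of_geometric [NeZero Lc]
    (hUg : ∃ C θ δ : ℝ, 0 ≤ C ∧ 0 ≤ θ ∧ θ < 1 ∧ 0 < δ ∧ ∀ k i : ℕ, i < k →
      LocStencil (fun κ' u' => (cE * (Lc : ℝ) ^ (2 * (d + 1))) ^ (k - i) •
        push₃ B[i, k] B[i, k] B[i, k]
          (fun κ u => -(push₃ (-R⁰[i]) (colM (KStepUnit (d := d) Lc i) Lc) R⁰[i] (reslot Sum.inl Sum.inr 𝒱) κ u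
            + push₃ (rowMM (KStepUnit (d := d) Lc i) Lc) R⁰[i] R⁰[i] (reslot Sum.inr Sum.inl 𝒱) κ u)) κ' u') (C * θ ^ (k - i)) δ) :
    ∃ C δ : ℝ, 0 < δ ∧ ∀ k : ℕ,
      LocStencil (∑ i ∈ Finset.range k, fun κ' u' => (cE * (Lc : ℝ) ^ (2 * (d + 1))) ^ (k - i) •
        push₃ B[i, k] B[i, k] B[i, k]
          (fun κ u => -(push₃ (-R⁰[i]) (colM (KStepUnit (d := d) Lc i) Lc) R⁰[i] (reslot Sum.inl Sum.inr 𝒱) κ u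
            + push₃ (rowMM (KStepUnit (d := d) Lc i) Lc) R⁰[i] R⁰[i] (reslot Sum.inr Sum.inl 𝒱) κ u)) κ' u') C δ := by
  obtain ⟨C, θ, δ, hC0, hθ0, hθ1, hδ, h⟩ := hUg
  exact ⟨C * (θ / (1 - θ)), δ, hδ, fun k => locStencil_sum_of_geometric hC0 hθ0 hθ1 k fun i hi => h k i hi⟩

/-- NOT IN PRINT; OUR BOOKKEEPING (the twin of leaf-01's `exists_hCv_of_geometric`).  **THE CONTACT LETTER `hCv` FROM A PER-LINEAGE GEOMETRIC LETTER** (no logs). -/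
theorem exists_hCv_of_geometric
    (hCg : ∃ C θ δ : ℝ, 0 ≤ C ∧ 0 ≤ θ ∧ θ < 1 ∧ 0 < δ ∧ ∀ k i : ℕ, i < k →
      LocStencil (transport (combUnitStepMap Lc cE) (i + 1) (k - 1 - i) (combUnitStepMap Lc cE i (fun κ u => cVH • tabs.V κ u))
        - fun κ' u' => (cE * (Lc : ℝ) ^ (2 * (d + 1))) ^ (k - i) •
          push₃ B[i, k] B[i, k] B[i, k]
            (fun κ u => -(push₃ (-R⁰[i]) (colM (KStepUnit (d := d) Lc i) Lc) R⁰[i] (reslot Sum.inl Sum.inr 𝒱) κ u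
              + push₃ (rowMM (KStepUnit (d := d) Lc i) Lc) R⁰[i] R⁰[i] (reslot Sum.inr Sum.inl 𝒱) κ u)) κ' u') (C * θ ^ (k - i)) δ) :
    ∃ C δ : ℝ, 0 < δ ∧ ∀ k : ℕ,
      LocStencil (∑ i ∈ Finset.range k, (transport (combUnitStepMap Lc cE) (i + 1) (k - 1 - i) (combUnitStepMap Lc cE i (fun κ u => cVH • tabs.V κ u))
        - fun κ' u' => (cE * (Lc : ℝ) ^ (2 * (d + 1))) ^ (k - i) •
          push₃ B[i, k] B[i, k] B[i, k]
            (fun κ u => -(push₃ (-R⁰[i]) (colM (KStepUnit (d := d) Lc i) Lc) R⁰[i] (reslot Sum.inl Sum.inr 𝒱) κ u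
              + push₃ (rowMM (KStepUnit (d := d) Lc i) Lc) R⁰[i] R⁰[i] (reslot Sum.inr Sum.inl 𝒱) κ u)) κ' u')) C δ := by
  obtain ⟨C, θ, δ, hC0, hθ0, hθ1, hδ, h⟩ := hCg
  exact ⟨C * (θ / (1 - θ)), δ, hδ, fun k => locStencil_sum_of_geometric hC0 hθ0 hθ1 k fun i hi => h k i hi⟩

/-- NOT IN PRINT; OUR BOOKKEEPING (the twin of leaf-01's `exists_hCv_of_polyGeometric`).  **THE CONTACT LETTER `hCv` FROM A PER-LINEAGE LETTER WITH LOGS**: per-lineage constants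
`C·(k−i)^p·θ^{k−i}` ⇒ the sum with `C·p!·θ∕(1−θ)^{p+1}` (leaf-03's `locStencil_sum_of_polyGeometric`). -/
theorem exists_hCv_of_polyGeometric (p : ℕ)
    (hCg : ∃ C θ δ : ℝ, 0 ≤ C ∧ 0 ≤ θ ∧ θ < 1 ∧ 0 < δ ∧ ∀ k i : ℕ, i < k →
      LocStencil (transport (combUnitStepMap Lc cE) (i + 1) (k - 1 - i) (combUnitStepMap Lc cE i (fun κ u => cVH • tabs.V κ u))
        - fun κ' u' => (cE * (Lc : ℝ) ^ (2 * (d + 1))) ^ (k - i) •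
          push₃ B[i, k] B[i, k] B[i, k]
            (fun κ u => -(push₃ (-R⁰[i]) (colM (KStepUnit (d := d) Lc i) Lc) R⁰[i] (reslot Sum.inl Sum.inr 𝒱) κ u
              + push₃ (rowMM (KStepUnit (d := d) Lc i) Lc) R⁰[i] R⁰[i] (reslot Sum.inr Sum.inl 𝒱) κ u)) κ' u')
        (C * (((k - i : ℕ) : ℝ) ^ p * θ ^ (k - i))) δ) :
    ∃ C δ : ℝ, 0 < δ ∧ ∀ k : ℕ,
      LocStencil (∑ i ∈ Finset.range k, (transport (combUnitStepMap Lc cE) (i + 1) (k - 1 - i) (combUnitStepMap Lc cE i (fun κ u => cVH • tabs.V κ u))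
        - fun κ' u' => (cE * (Lc : ℝ) ^ (2 * (d + 1))) ^ (k - i) •
          push₃ B[i, k] B[i, k] B[i, k]
            (fun κ u => -(push₃ (-R⁰[i]) (colM (KStepUnit (d := d) Lc i) Lc) R⁰[i] (reslot Sum.inl Sum.inr 𝒱) κ u
              + push₃ (rowMM (KStepUnit (d := d) Lc i) Lc) R⁰[i] R⁰[i] (reslot Sum.inr Sum.inl 𝒱) κ u)) κ' u')) C δ := by
  obtain ⟨C, θ, δ, hC0, hθ0, hθ1, hδ, h⟩ := hCg
  exact ⟨C * ((p.factorial : ℝ) * θ / (1 - θ) ^ (p + 1)), δ, hδ, fun k =>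
    locStencil_sum_of_polyGeometric p hC0 hθ0 hθ1 k fun i hi => h k i hi⟩

include hVff hVmm in
/-- NOT IN PRINT; OUR BOOKKEEPING ((III′) V half, END SHAPE, generic `d`; the twin of leaf-01's `exists_hBv_of_geometric`).  **THE (III′) V-BORN ROW FROM TWO PER-LINEAGE GEOMETRIC
LETTERS** — one for every weighted UNDRESSED V lineage on the transported table and one for every CONTACT term, constants `C·θ^{k−i}`, `θ < 1`, one rate — give the letter `hV` of
M.57's `exists_hB_of_sectors`.  This is the statement the (III′) V half has to prove, lineage by lineage; nothing of it is claimed here. -/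
theorem exists_hBv_of_geometric
    (hUg : ∃ C θ δ : ℝ, 0 ≤ C ∧ 0 ≤ θ ∧ θ < 1 ∧ 0 < δ ∧ ∀ k i : ℕ, i < k →
      LocStencil (fun κ' u' => (cE * (Lc : ℝ) ^ (2 * (d + 1))) ^ (k - i) •
        push₃ B[i, k] B[i, k] B[i, k]
          (fun κ u => -(push₃ (-R⁰[i]) (colM (KStepUnit (d := d) Lc i) Lc) R⁰[i] (reslot Sum.inl Sum.inr 𝒱) κ u
            + push₃ (rowMM (KStepUnit (d := d) Lc i) Lc) R⁰[i] R⁰[i] (reslot Sum.inr Sum.inl 𝒱) κ u)) κ' u') (C * θ ^ (k - i)) δ)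
    (hCg : ∃ C θ δ : ℝ, 0 ≤ C ∧ 0 ≤ θ ∧ θ < 1 ∧ 0 < δ ∧ ∀ k i : ℕ, i < k →
      LocStencil (transport (combUnitStepMap Lc cE) (i + 1) (k - 1 - i) (combUnitStepMap Lc cE i (fun κ u => cVH • tabs.V κ u))
        - fun κ' u' => (cE * (Lc : ℝ) ^ (2 * (d + 1))) ^ (k - i) •
          push₃ B[i, k] B[i, k] B[i, k]
            (fun κ u => -(push₃ (-R⁰[i]) (colM (KStepUnit (d := d) Lc i) Lc) R⁰[i] (reslot Sum.inl Sum.inr 𝒱) κ u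
              + push₃ (rowMM (KStepUnit (d := d) Lc i) Lc) R⁰[i] R⁰[i] (reslot Sum.inr Sum.inl 𝒱) κ u)) κ' u') (C * θ ^ (k - i)) δ) :
    ∃ C δ : ℝ, 0 < δ ∧ ∀ k : ℕ, LocStencil (unitS (sfStep Lc k) (smStep d Lc k) (combBornOf Lc tabs cE cVH 0 k)) C δ :=
  exists_hBv_of_letters tabs hVff hVmm cE cVH (exists_hUv_of_geometric tabs cE cVH hUg) (exists_hCv_of_geometric tabs cE cVH hCg)

include hVff hVmm in
/-- NOT IN PRINT; OUR BOOKKEEPING ((III′) V half, END SHAPE with logs in the contact letter; the twin of leaf-01's `exists_hBv_of_geometric_poly`).  **THE (III′) V-BORN ROW FROM A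
GEOMETRIC UNDRESSED LETTER AND A POLY-GEOMETRIC CONTACT LETTER** (`C·(k−i)^p·θ^{k−i}`). -/
theorem exists_hBv_of_geometric_poly (p : ℕ)
    (hUg : ∃ C θ δ : ℝ, 0 ≤ C ∧ 0 ≤ θ ∧ θ < 1 ∧ 0 < δ ∧ ∀ k i : ℕ, i < k →
      LocStencil (fun κ' u' => (cE * (Lc : ℝ) ^ (2 * (d + 1))) ^ (k - i) •
        push₃ B[i, k] B[i, k] B[i, k]
          (fun κ u => -(push₃ (-R⁰[i]) (colM (KStepUnit (d := d) Lc i) Lc) R⁰[i] (reslot Sum.inl Sum.inr 𝒱) κ u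
            + push₃ (rowMM (KStepUnit (d := d) Lc i) Lc) R⁰[i] R⁰[i] (reslot Sum.inr Sum.inl 𝒱) κ u)) κ' u') (C * θ ^ (k - i)) δ)
    (hCg : ∃ C θ δ : ℝ, 0 ≤ C ∧ 0 ≤ θ ∧ θ < 1 ∧ 0 < δ ∧ ∀ k i : ℕ, i < k →
      LocStencil (transport (combUnitStepMap Lc cE) (i + 1) (k - 1 - i) (combUnitStepMap Lc cE i (fun κ u => cVH • tabs.V κ u))
        - fun κ' u' => (cE * (Lc : ℝ) ^ (2 * (d + 1))) ^ (k - i) •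
          push₃ B[i, k] B[i, k] B[i, k]
            (fun κ u => -(push₃ (-R⁰[i]) (colM (KStepUnit (d := d) Lc i) Lc) R⁰[i] (reslot Sum.inl Sum.inr 𝒱) κ u
              + push₃ (rowMM (KStepUnit (d := d) Lc i) Lc) R⁰[i] R⁰[i] (reslot Sum.inr Sum.inl 𝒱) κ u)) κ' u')
        (C * (((k - i : ℕ) : ℝ) ^ p * θ ^ (k - i))) δ) :
    ∃ C δ : ℝ, 0 < δ ∧ ∀ k : ℕ, LocStencil (unitS (sfStep Lc k) (smStep d Lc k) (combBornOf Lc tabs cE cVH 0 k)) C δ :=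
  exists_hBv_of_letters tabs hVff hVmm cE cVH (exists_hUv_of_geometric tabs cE cVH hUg) (exists_hCv_of_polyGeometric tabs cE cVH p hCg)

end Summit.QuantumFields.BalabanUV.Beta.GAN24.CombBornBorderLetters

end
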